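import Mathlib
import Summits.Ventures.PercRepro.TriangleCapFiveBelowPair

/-!
# PercRepro — FIVE BELOW THE DIAGONAL, `a = 3`, EVERY DEGREE `≥ 3`: THE CONVEXITY BOUND (p3, gen 40; part 149)

On the cells `m = 3k − 14` (`k ≥ 11`) with every degree `≥ 3`, the excesses `f(v) = d(v) − 3` sum to
`s = 2m − 3k = 3k − 28`, the largest excess `M = f(x*)` is `≤ k − 5` (non-domination, part 148) and every other
excess satisfies `f(v) + M ≤ 2k − 12` (the pair lemma of part 148). Hence
`Σ f² = M² + Σ_{v ≠ x*} f(v)² ≤ M² + min(M, 2k − 12 − M) · (s − M)`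
(`sum_erase_sq_le_mul`, `sum_erase_sq_add_le`), which is `≤ (k − 6)(3k − 28)` for `M ≤ k − 6` and
`≤ (k − 5)² + (k − 7)(2k − 23)` for `M = k − 5` — both `≤ 3k² − 46k + 198 = mk − 5(k − 6) − 6·2m + 9k`.
So `Σ_v d(v)² + 5 (k − 6) ≤ m k` (`dense_stability_five_three_of_min_degree`). Axioms: standard.
-/

namespace PercRepro

namespace TriangleCap

namespace C047

open Finset

variable {V : Type*} [Fintype V] [DecidableEq V]

/-- `Σ_{v ≠ x} f(v)² ≤ M · Σ_{v ≠ x} f(v)` when every `f(v) ≤ M`. -/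
theorem sum_erase_sq_le_mul (f : V → ℕ) (x : V) (M : ℕ) (hM : ∀ v, f v ≤ M) :
    ∑ v ∈ univ.erase x, f v * f v ≤ M * ∑ v ∈ univ.erase x, f v := by
  rw [mul_sum]
  exact sum_le_sum (fun v _ => Nat.mul_le_mul_right _ (hM v))

/-- `Σ_{v ≠ x} f(v)² + M · Σ_{v ≠ x} f(v) ≤ P · Σ_{v ≠ x} f(v)` when `f(v) + M ≤ P` off `x`. -/
theorem sum_erase_sq_add_le (f : V → ℕ) (x : V) (M P : ℕ) (hP : ∀ v, v ≠ x → f v + M ≤ P) :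
    ∑ v ∈ univ.erase x, f v * f v + M * ∑ v ∈ univ.erase x, f v ≤ P * ∑ v ∈ univ.erase x, f v := by
  rw [mul_sum, mul_sum, ← sum_add_distrib]
  apply sum_le_sum
  intro v hv
  have h := hP v (mem_erase.mp hv).1
  calc f v * f v + M * f v = (f v + M) * f v := by ring
    _ ≤ P * f v := Nat.mul_le_mul_right _ h

/-- **THE CONVEXITY CLOSING:** `M + s' = 3j + 5`, `M ≤ j + 6`, `q ≤ M s'`, `q + M s' ≤ (2j + 10) s'` ⇒
`M² + q ≤ 3j² + 20j + 55`. -/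
theorem convexity_closing (j M s' q : ℕ) (hMs : M + s' = 3 * j + 5) (hM : M ≤ j + 6) (hA : q ≤ M * s')
    (hB : q + M * s' ≤ (2 * j + 10) * s') : M * M + q ≤ 3 * j * j + 20 * j + 55 := by
  rcases Nat.lt_or_ge M (j + 6) with h5 | h6
  · have h1 : M * M + q ≤ M * (M + s') := by nlinarith
    rw [hMs] at h1
    have h2 : M * (3 * j + 5) ≤ (j + 5) * (3 * j + 5) := Nat.mul_le_mul_right _ (by omega)
    nlinarith
  · have hM6 : M = j + 6 := by omega
    subst hM6
    have hs : s' + 1 = 2 * j := by omega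
    obtain ⟨j', rfl⟩ : ∃ j', j = j' + 1 := ⟨j - 1, by omega⟩
    have hs' : s' = 2 * j' + 1 := by omega
    subst hs'
    nlinarith

/-- **FIVE BELOW THE DIAGONAL, `a = 3`, EVERY DEGREE `≥ 3`:** `K₄⁻`-free, `k ≥ 11`, `m + 14 = 3k`, every degree
`≥ 3` ⇒ `Σ_v d(v)² + 5 (k − 6) ≤ m k`. -/
theorem dense_stability_five_three_of_min_degree (D : SimpleGraph V) [DecidableRel D.Adj] (hK : K4mFree D)
    (hk : 11 ≤ Fintype.card V) (hm : D.edgeFinset.card + 14 = 3 * Fintype.card V) (hdeg : ∀ z, 3 ≤ deg D z) :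
    ∑ v, deg D v * deg D v + 5 * (Fintype.card V - 6) ≤ D.edgeFinset.card * Fintype.card V := by
  have hsum := sum_deg_eq D
  obtain ⟨x, -, hx⟩ := exists_max_image univ (deg D) (card_pos.mp (by rw [card_univ]; omega))
  obtain ⟨f, hf⟩ : ∃ f : V → ℕ, ∀ v, deg D v = f v + 3 :=
    ⟨fun v => deg D v - 3, fun v => (Nat.sub_add_cancel (hdeg v)).symm⟩
  have e1 : ∑ v, deg D v = ∑ v, f v + 3 * Fintype.card V := by
    rw [sum_congr rfl (fun v _ => hf v), sum_add_distrib, sum_const, smul_eq_mul, card_univ]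
    ring
  have e2 : ∀ v, deg D v * deg D v = f v * f v + 6 * f v + 9 := fun v => by rw [hf v]; ring
  have e3 : ∑ v, deg D v * deg D v = ∑ v, f v * f v + 6 * ∑ v, f v + 9 * Fintype.card V := by
    rw [sum_congr rfl (fun v _ => e2 v), sum_add_distrib, sum_add_distrib, ← mul_sum, sum_const, smul_eq_mul,
      card_univ]
    ring
  -- the largest excess and the pair bound
  have hM : ∀ v, f v ≤ f x := fun v => by have := hx v (mem_univ v); rw [hf v, hf x] at this; omega
  have hMk : f x + 5 ≤ Fintype.card V := by
    have := deg_add_two_le_card_of_dense D hK (by omega) x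
    rw [hf x] at this
    omega
  have hP : ∀ v, v ≠ x → f v + f x + 12 ≤ 2 * Fintype.card V := by
    intro v hv
    have := deg_add_deg_add_six_le D hK (by omega) (by omega) hv
    rw [hf v, hf x] at this
    omega
  have hsq := add_sum_erase univ (fun v => f v * f v) (mem_univ x)
  have hs := add_sum_erase univ f (mem_univ x)
  have hA := sum_erase_sq_le_mul f x (f x) hM
  have hB := sum_erase_sq_add_le f x (f x) (2 * Fintype.card V - 12) (fun v hv => by have := hP v hv; omega)
  -- the arithmetic
  obtain ⟨j, hj⟩ : ∃ j, Fintype.card V = j + 11 := ⟨Fintype.card V - 11, by omega⟩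
  have hmj : D.edgeFinset.card = 3 * j + 19 := by omega
  rw [e3, hmj, hj]
  have e4 : j + 11 - 6 = j + 5 := by omega
  rw [e4]
  have e5 : 2 * (j + 11) - 12 = 2 * j + 10 := by omega
  rw [hj, e5] at hB
  rw [hj] at hMk e1
  rw [hmj] at hsum
  generalize hq : ∑ v ∈ univ.erase x, f v * f v = q at hsq hA hB
  generalize hs' : ∑ v ∈ univ.erase x, f v = s' at hs hA hB
  generalize hM' : f x = M at hsq hs hA hB hMk
  rw [← hsq, ← hs]
  have hMs : M + s' = 3 * j + 5 := by omega
  have hclose := convexity_closing j M s' q hMs (by omega) hA hB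
  nlinarith

end C047

end TriangleCap

end PercRepro
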